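/-
Copyright (c) 2026 the pub-hodgecm-mathlib formalisation cell (harness21).  Prover seat hodgecm-mathlib-K2E3-p04 (g2), Track B ∕ K2-LIT
(build stream 29), h413 = `stmt-HodgeConjecture-24833`, line `K2_E3_EllipticInputs`, unit U4 «Keys» — road I («Keys' own road»: the rank-one intertwining
integral), brick I-3g «MACDONALD'S FORMULA AT THE NON-DYADIC NON-SPLIT PLACES».  2026-09-04.
-/
import Summits.HodgeConjecture.HodgeConjecture.Theorems.K2E3SphericalCFunctionFactorization   -- ★ (this base, g2): `c_w(χ) = (μ(B₁) + μ(B_q) z∕q)(1 − z∕q)∕(1 − z²)`, every non-split `v`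
import Summits.HodgeConjecture.HodgeConjecture.Theorems.K2E3HeightBallIndexInert               -- ★ p856166 (this base, g2): `μ(B_q) = q_F · μ(B₁)` at inert `v ∤ 2`; brings ★ BallRatios (`N𝔓_w = q_F²`, `|·|_w = q_w^{−ord}`)
import Summits.HodgeConjecture.HodgeConjecture.Theorems.K2E3HeightBallIndexRamified            -- ★ (this base, g2): `μ(B_q) = q_F · μ(B₁)` and `‖ϖ‖ = q_F⁻¹` at tame-ramified `v ∤ 2`
import HarnessLib

/-!
# h413 ∕ Track B «K2-LIT», unit U4 «Keys», road I brick I-3g: MACDONALD'S FORMULA FOR THE `c`-FUNCTION OF `U(Φ₃)(L⁺_v)` AT THE NON-DYADIC NON-SPLIT PLACES —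
# inert: `c_w(χ) = μ(B₁)·(1 + z∕q_F)(1 − z∕q_F²)∕(1 − z²)`;  tame-ramified: `c_w(χ) = μ(B₁)·(1 − z∕q_F)∕(1 − z)`  (`z = χ₁(ϖ)`, `|z| < 1`)   [Rogawski1990 §4.5; Casselman1995 §6.4; Keys1984 §4]

Cell `pub/hodgecm-mathlib`, crux H413 = `stmt-HodgeConjecture-24833` (lane `--supports … --as helper`), route HCCMUnconditional; dealer K2E3-plan (g1) (23:02Z ∕ 23:40:43Z (d)).
THEOREMS ONLY (0 def ∕ 0 instance ∕ 0 notation ∕ 0 sorry); ★-only imports.  THE END OF ROAD I-3: the rank-one intertwining integral `J(w, χ)` of ★ RUNG 3 (p855230 ∕ p855375) acts on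
the spherical vector of an unramified `i_G(χ₁, χ₂)` (`χ₂ = 1`, `|χ₁| = ‖·‖_E^s`, `s > 0`) by HARISH-CHANDRA's `c_w(χ) = ∫_N f_K(w₀ n) dμ` (★ I-2a p855557), and at a place `v` of `L⁺`
INERT in `L` with `v ∤ 2` that number is, in closed form, **`μ(B₁) f_K(1) · (1 + q_F⁻¹ z)(1 − q_F⁻² z)∕(1 − z²)`** with `z = χ₁(ϖ)` and `q_F = N𝔭_v` — Macdonald's formula for the
quasi-split unramified `U(3)` ([Rogawski1990, §4.5]: the relative root system is `{±a, ±2a}` with `q_a = q_F²`, `q_{2a} = q_F`; [Casselman1995, §6.4]).  Chain: ★ p855911 (shell expansion) →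
★ p856066 (two-step geometric series) → ★ `K2E3SphericalCFunctionFactorization` (numerator factors, one index left) → ★ `K2E3HeightBallIndexInert` (`[B_q : B₁] = q_F`).

THE MATHEMATICS.  `a = ‖ϖ‖ = |ϖ_w|_w = (N𝔓_w)⁻¹ = q_F⁻²` (★ `unitModulusChar_localRing_eq_prod`, ★ `normAbs_eq_inv_zpow_of_valued_eq`, ★ `absNorm_placesOver_eq_sq_of_nonsplit_of_isUnramifiedIn`);
`μ(B_{a⁻¹}) = q_F μ(B₁)` (★ `measureReal_heightBall_inv_eq_mul`); substitute in ★ `integral_cellFun_eq_factoredForm`: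
`(μ(B₁) + q_F μ(B₁)·q_F⁻² z)(1 − q_F⁻² z) = μ(B₁)(1 + z∕q_F)(1 − z∕q_F²)`.
* §1 `unitModulusChar_uniformizer_eq_inert` — `‖ϖ‖ = (q_F²)⁻¹` for ANY uniformiser unit at an inert place.
* §2 **`integral_cellFun_eq_macdonald_inert`** — the displayed closed form of `∫_N f(w₀ u) dμ` for a `K_v`-fixed `f`.
* §3 **`exists_intertwiningIntegral_sphericalVector_eq_macdonald_smul`** — docked on ★ I-2a: `J f_K = (μ(B₁)(1 + z∕q_F)(1 − z∕q_F²)(1 − z²)⁻¹ · f_K(1)) • f'_K`.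
* §4 the TAME-RAMIFIED place (`e(w|v) = 2`, `v ∤ 2`, `q = q_F`, index `q_F` ★ `K2E3HeightBallIndexRamified`): **`integral_cellFun_eq_macdonald_ramified`** — `∫_N f(w₀ u) dμ = μ(B₁)·(1 − z∕q_F)(1 − z)⁻¹·f(1)`
  (`(1 + q_F·q_F⁻¹z)(1 − q_F⁻¹z)∕(1 − z²) = (1 − z∕q_F)∕(1 − z)`: the rank-one shape `q_a = q_F`, `q_{2a} = 1`; only the zero `z = q_F` ⟷ `χ₁ = ‖·‖_E` at `z⁻¹`, as `ω_{E∕F}` is ramified there)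
  and its ★ I-2a docking **`exists_intertwiningIntegral_sphericalVector_eq_macdonald_ramified_smul`**.
CONSEQUENCE recorded in the docstrings (not a separate socket): for `|z| < 1` the bracket does not vanish (`|z∕q_F| < 1`, `|z∕q_F²| < 1`), so `J(w, χ) f_K ≠ 0` in the whole convergent
cone — reducibility of `i(χ)` (U4-f) is detected only by the continued factor `c_w(wχ)` at `z⁻¹`, i.e. at `z ∈ {q_F⁻², −q_F⁻¹}` ⟷ `χ₁ = ‖·‖_E`, `χ₁ = η‖·‖_E^{1∕2}` with `η(ϖ) = −1`
([Keys1984, §7 Thm (2)]; [Rogawski1990, §12.2 (1)–(2)]) — the Iwahori-level computation of road II ∕ road I-4.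

HONEST LABEL.  HC_CM is proved only modulo the 7 printed citations (2 remaining named inputs: hLiu418 = `stmt-HodgeConjecture-24832`, h413 = `stmt-HodgeConjecture-24833`) until
rung 0 closes; count-neutral (no socket is paid by this file).  Dyadic places are NOT treated.

## References
* [Rogawski1990] J. D. Rogawski, *Automorphic Representations of Unitary Groups in Three Variables* (1990), §4.5 p. 45 (unramified `c`-function ∕ Plancherel measure of `U(3)`), §12.2 p. 173.
* [Casselman1995] W. Casselman, *Introduction to the theory of admissible representations of `p`-adic reductive groups* (1995), §6.4 pp. 62–64.
* [Keys1984] D. Keys, *Principal series representations of special unitary groups over local fields*, Compositio Math. 51 (1984), §4, §7 Thm (2).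
* [NeukirchANT1999] J. Neukirch, *Algebraic Number Theory* (1999), Ch. II §6 (`|·|_w = (N𝔓_w)^{−ord_w}`).
-/

set_option autoImplicit false
-- the mandated namespace repeats the single-problem summit's segment (`HodgeConjecture.HodgeConjecture`)
set_option linter.dupNamespace false

noncomputable section

open NumberField IsDedekindDomain MeasureTheory
open scoped Matrix NNReal ENNReal

open Literature.NumberTheory Literature.NumberTheory.Automorphic Literature.NumberTheory.Automorphic.UnitaryGroup
open Literature.NumberTheory.GaloisRepresentations Literature.NumberTheory.GaloisRepresentations.IsNonarchimedeanLocalField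

namespace Summit.HodgeConjecture.HodgeConjecture.Cruxes.H413.K2E3SphericalCFunctionMacdonald

variable (L : Type) [Field L] [NumberField L] [IsCMField L] (v : HeightOneSpectrum (𝓞 ↥(maximalRealSubfield L)))

/-! ## §1 `‖ϖ‖ = q_F⁻²` for every uniformiser unit at an inert place -/

/-- **`‖ϖ‖ = (q_F²)⁻¹`** for ANY uniformiser unit `ϖ` of `E_v = Π_{w∣v} L_w` (`|ϖ_w|_w = exp(−1)`) at a non-split place `v` unramified in `L` (`q_F = N𝔭_v`, `N𝔓_w = q_F²`): one factor
(★ `unitModulusChar_localRing_eq_prod`), `|ϖ_w|_w = (N𝔓_w)⁻¹` (★ `normAbs_eq_inv_zpow_of_valued_eq`), ★ `absNorm_placesOver_eq_sq_of_nonsplit_of_isUnramifiedIn`.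
[cite: NeukirchANT1999, Ch. II §6] [cite: Rogawski1990, §12.2 p. 173] -/
theorem unitModulusChar_uniformizer_eq_inert (w : PlacesOver L v) (hw : IsCMField.complexConj L • w.1 = w.1) (hunrL : Algebra.IsUnramifiedIn (𝓞 L) v.asIdeal)
    (ϖ : (LocalRing L v)ˣ) (hϖ : ∀ w : PlacesOver L v, Valued.v ((ϖ : LocalRing L v) w) = WithZero.exp (-1 : ℤ)) :
    unitModulusChar (LocalRing L v) ϖ = (((Ideal.absNorm v.asIdeal : ℕ) : ℝ≥0) ^ 2)⁻¹ := by
  haveI : Algebra.IsQuadraticExtension ↥(maximalRealSubfield L) L := IsCMField.isQuadraticExtension L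
  haveI : Subsingleton (PlacesOver L v) := PlacesOver.subsingleton_of_smul_eq (IsCMField.complexConj L) (IsCMField.complexConj_ne_one L) w hw
  rw [unitModulusChar_localRing_eq_prod, Fintype.prod_subsingleton _ w, normAbs_eq_inv_zpow_of_valued_eq (v := w.1) (hϖ w), neg_neg, zpow_one,
    residueFieldCard_adicCompletion_eq_absNorm, Rogawski1990.absNorm_placesOver_eq_sq_of_nonsplit_of_isUnramifiedIn L v w hw hunrL, Nat.cast_pow]

/-! ## §2 Macdonald's formula for `∫_N f(w₀ u) dμ` -/

set_option synthInstance.maxHeartbeats 400000 in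
set_option maxHeartbeats 8000000 in
-- statement∕proof over the `SmoothInd` carrier of ★ `cmPrincipalSeries` (class of ★ `K2E3SphericalCFunctionFactorization.integral_cellFun_eq_factoredForm`)
/-- **MACDONALD'S FORMULA, INERT NON-DYADIC PLACE.**  `v` non-split, UNRAMIFIED in `L`, `v ∤ 2` (`q_F = N𝔭_v`), `w₀` of matrix `Φ₃`, `μ` a Haar measure of `N(L⁺_v)`, `ϖ` a uniformiser unit, `χ₂`
continuous with `χ₂(−1) = 1`, `χ₁` UNRAMIFIED with `|χ₁(x)| = ‖x‖^s`, `s > 0`, `z = χ₁(ϖ)`, `f` a `K_v`-fixed vector of ★ `cmPrincipalSeries L 3 v (χ₁, χ₂)`.  Then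
**`∫_N f(w₀ u) dμ = μ(B₁) · (1 + z∕q_F)(1 − z∕q_F²)(1 − z²)⁻¹ · f(1)`**, `B₁ = {‖u₀₂‖ ≤ 1} = N(𝒪_v)` (★ `integral_cellFun_eq_factoredForm` + ★ `measureReal_heightBall_inv_eq_mul` + §1).
[cite: Rogawski1990, §4.5 p. 45] [cite: Casselman1995, §6.4 pp. 62–64] [cite: Keys1984, §4] -/
theorem integral_cellFun_eq_macdonald_inert (hns : ∀ w : PlacesOver L v, IsCMField.complexConj L • w.1 = w.1) (w : PlacesOver L v)
    (hunrL : Algebra.IsUnramifiedIn (𝓞 L) v.asIdeal) (h2w : Valued.v (2 : w.1.adicCompletion L) = 1)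
    (χ₁ : (LocalRing L v)ˣ →* ℂˣ) (χ₂ : ↥(normOneUnits (conjLocal L (IsCMField.complexConj L) v)) →* ℂˣ)
    (h₂ : Continuous fun x => ((χ₂ x : ℂˣ) : ℂ)) (hχ₂ : χ₂ ⟨-1, F0P3cStCharTSBigCellFactorisation.neg_one_mem_normOneUnits (conjLocal L (IsCMField.complexConj L) v)⟩ = 1)
    (hunr : ∀ u ∈ (Submonoid.pi Set.univ (fun w : PlacesOver L v => (w.1.adicCompletionIntegers L).toSubring.toSubmonoid)).units, χ₁ u = 1) {s : ℝ} (hs : 0 < s)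
    (hχ₁ : ∀ x : (LocalRing L v)ˣ, ‖((χ₁ x : ℂˣ) : ℂ)‖ = ((unitModulusChar (LocalRing L v) x : ℝ≥0) : ℝ) ^ s)
    (ϖ : (LocalRing L v)ˣ) (hϖ : ∀ w : PlacesOver L v, Valued.v ((ϖ : LocalRing L v) w) = WithZero.exp (-1 : ℤ))
    (w₀ : ↥(unitaryGroupOfForm (conjLocal L (IsCMField.complexConj L) v) (cmLocalForm L 3 v))) (hw₀ : Units.val (w₀ : GL (Fin 3) (LocalRing L v)) = cmLocalForm L 3 v)
    [MeasurableSpace ↥(cmBorelTriple L 3 v).N] [BorelSpace ↥(cmBorelTriple L 3 v).N] (μ : Measure ↥(cmBorelTriple L 3 v).N) [μ.IsHaarMeasure]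
    (f : haveI := locallyCompactSpace_cmBorelU L 3 v
      Representation.SmoothInd (cmBorelTriple L 3 v).P (Representation.twist (((Representation.trivial ℂ ↥(torusU (conjLocal L (IsCMField.complexConj L) v) (cmLocalForm L 3 v)) ℂ).twist
        (cmTorusCharPair L v χ₁ χ₂)).comp (cmBorelTriple L 3 v).proj) (rootDeltaChar (cmBorelTriple L 3 v).P)))
    (hf : haveI := locallyCompactSpace_cmBorelU L 3 v
      f ∈ (Representation.smoothIndRep (cmBorelTriple L 3 v).P _).fixedPoints (cmLocalIntegralLevel L 3 (Matrix.of fun i j : Fin 3 => if i.val + j.val + 1 = 3 then (1 : L) else 0) v)) :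
    ∫ u : ↥(cmBorelTriple L 3 v).N, f.toFun (w₀ * (u : ↥(unitaryGroupOfForm (conjLocal L (IsCMField.complexConj L) v) (cmLocalForm L 3 v)))) ∂μ =
      (μ.real {u : ↥(cmBorelTriple L 3 v).N | (((∏ w' : PlacesOver L v, normAbs (w'.1.adicCompletion L) ((((((u : ↥(unitaryGroupOfForm (conjLocal L (IsCMField.complexConj L) v) (cmLocalForm L 3 v)))) : GL (Fin 3) (LocalRing L v)) : Matrix (Fin 3) (Fin 3) (LocalRing L v)) 0 2) w')) : ℝ≥0) : ℝ) ≤ 1} : ℂ) * ((1 + ((χ₁ ϖ : ℂˣ) : ℂ) / ((Ideal.absNorm v.asIdeal : ℕ) : ℂ)) * (1 - ((χ₁ ϖ : ℂˣ) : ℂ) / ((Ideal.absNorm v.asIdeal : ℕ) : ℂ) ^ 2) * (1 - ((χ₁ ϖ : ℂˣ) : ℂ) ^ 2)⁻¹) * f.toFun 1 := by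
  have hw := hns w
  have hq0 : ((Ideal.absNorm v.asIdeal : ℕ) : ℂ) ≠ 0 := by exact_mod_cast fun h => v.ne_bot (Ideal.absNorm_eq_zero_iff.1 h)
  have ha : ((unitModulusChar (LocalRing L v) ϖ : ℝ≥0) : ℝ) = ((((Ideal.absNorm v.asIdeal : ℕ) : ℝ)) ^ 2)⁻¹ := by
    rw [unitModulusChar_uniformizer_eq_inert L v w hw hunrL ϖ hϖ, NNReal.coe_inv, NNReal.coe_pow, NNReal.coe_natCast]
  rw [K2E3SphericalCFunctionFactorization.integral_cellFun_eq_factoredForm L v hns χ₁ χ₂ h₂ hχ₂ hunr hs hχ₁ ϖ hϖ w₀ hw₀ μ f hf,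
    K2E3HeightBallIndexInert.measureReal_heightBall_inv_eq_mul L v w hw hunrL h2w ϖ hϖ μ, ha]
  set M₀ : ℝ := μ.real {u : ↥(cmBorelTriple L 3 v).N | (((∏ w' : PlacesOver L v, normAbs (w'.1.adicCompletion L) ((((((u : ↥(unitaryGroupOfForm (conjLocal L (IsCMField.complexConj L) v) (cmLocalForm L 3 v)))) : GL (Fin 3) (LocalRing L v)) : Matrix (Fin 3) (Fin 3) (LocalRing L v)) 0 2) w')) : ℝ≥0) : ℝ) ≤ 1} with hM₀
  push_cast
  field_simp

/-! ## §3 Harish-Chandra's `c`-function in Macdonald's form -/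

set_option synthInstance.maxHeartbeats 400000 in
set_option maxHeartbeats 8000000 in
-- statement∕proof over two `SmoothInd` carriers of ★ `cmPrincipalSeries` (class of ★ `K2E3SphericalCFunctionFactorization.exists_intertwiningIntegral_sphericalVector_eq_factoredForm_smul`)
/-- **HARISH-CHANDRA'S `c`-FUNCTION OF `U(Φ₃)(L⁺_v)` IN MACDONALD'S FORM** (docked on ★ I-2a).  `v` non-split, UNRAMIFIED in `L`, `v ∤ 2`, `q_F = N𝔭_v`; `w₀` of matrix `Φ₃`, `μ` a Haar measure of
`N(L⁺_v)`, `ϖ` a uniformiser unit; `χ₁, χ₂` continuous, `χ₂(−1) = 1`, `χ₁` UNRAMIFIED with `|χ₁| = ‖·‖^s`, `s > 0`, `z = χ₁(ϖ)`; `f_K ∈ i_G(χ)^{K_v}`, `f'_K ∈ i_G(wχ)^{K_v}`, `f'_K(1) = 1`.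
Then the intertwining integral `J ≠ 0` of ★ RUNG 3 (`(J f)(g) = ∫_N f(w₀ n g) dμ`) satisfies **`J f_K = (μ(B₁)·(1 + z∕q_F)(1 − z∕q_F²)(1 − z²)⁻¹ · f_K(1)) • f'_K`**; with `μ(N(𝒪_v)) = 1`, `f_K(1) = 1`:
**`c_w(χ) = (1 + q_F⁻¹ z)(1 − q_F⁻² z) ∕ (1 − z²)`** ([Rogawski1990, §4.5 p. 45]).  Non-vanishing for `|z| < 1` is plain from the factors; the zeros `z = −q_F`, `z = q_F²` of the
numerator, read at `z⁻¹`, are Keys' reducibility points `χ₁ = η‖·‖_E^{1∕2}` (`η(ϖ) = −1`) and `χ₁ = ‖·‖_E` of the contracting unramified line. [cite: Rogawski1990, §4.5 p. 45; §12.2 p. 173] [cite: Casselman1995, §6.4 pp. 62–64] [cite: Keys1984, §4, §7 Thm (2)] -/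
theorem exists_intertwiningIntegral_sphericalVector_eq_macdonald_smul (hns : ∀ w : PlacesOver L v, IsCMField.complexConj L • w.1 = w.1) (w : PlacesOver L v)
    (hunrL : Algebra.IsUnramifiedIn (𝓞 L) v.asIdeal) (h2w : Valued.v (2 : w.1.adicCompletion L) = 1)
    (χ₁ : (LocalRing L v)ˣ →* ℂˣ) (χ₂ : ↥(normOneUnits (conjLocal L (IsCMField.complexConj L) v)) →* ℂˣ)
    (h₁ : Continuous fun x => ((χ₁ x : ℂˣ) : ℂ)) (h₂ : Continuous fun x => ((χ₂ x : ℂˣ) : ℂ)) (hχ₂ : χ₂ ⟨-1, F0P3cStCharTSBigCellFactorisation.neg_one_mem_normOneUnits (conjLocal L (IsCMField.complexConj L) v)⟩ = 1)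
    (hunr : ∀ u ∈ (Submonoid.pi Set.univ (fun w : PlacesOver L v => (w.1.adicCompletionIntegers L).toSubring.toSubmonoid)).units, χ₁ u = 1) {s : ℝ} (hs : 0 < s)
    (hχ₁ : ∀ x : (LocalRing L v)ˣ, ‖((χ₁ x : ℂˣ) : ℂ)‖ = ((unitModulusChar (LocalRing L v) x : ℝ≥0) : ℝ) ^ s)
    (ϖ : (LocalRing L v)ˣ) (hϖ : ∀ w : PlacesOver L v, Valued.v ((ϖ : LocalRing L v) w) = WithZero.exp (-1 : ℤ))
    (w₀ : ↥(unitaryGroupOfForm (conjLocal L (IsCMField.complexConj L) v) (cmLocalForm L 3 v))) (hw₀ : Units.val (w₀ : GL (Fin 3) (LocalRing L v)) = cmLocalForm L 3 v)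
    [MeasurableSpace ↥(cmBorelTriple L 3 v).N] [BorelSpace ↥(cmBorelTriple L 3 v).N] (μ : Measure ↥(cmBorelTriple L 3 v).N) [μ.IsHaarMeasure]
    (fK : haveI := locallyCompactSpace_cmBorelU L 3 v
      Representation.SmoothInd (cmBorelTriple L 3 v).P (Representation.twist (((Representation.trivial ℂ ↥(torusU (conjLocal L (IsCMField.complexConj L) v) (cmLocalForm L 3 v)) ℂ).twist
        (cmTorusCharPair L v χ₁ χ₂)).comp (cmBorelTriple L 3 v).proj) (rootDeltaChar (cmBorelTriple L 3 v).P)))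
    (hfK : haveI := locallyCompactSpace_cmBorelU L 3 v
      fK ∈ (Representation.smoothIndRep (cmBorelTriple L 3 v).P _).fixedPoints (cmLocalIntegralLevel L 3 (Matrix.of fun i j : Fin 3 => if i.val + j.val + 1 = 3 then (1 : L) else 0) v))
    (fK' : haveI := locallyCompactSpace_cmBorelU L 3 v
      Representation.SmoothInd (cmBorelTriple L 3 v).P (Representation.twist (((Representation.trivial ℂ ↥(torusU (conjLocal L (IsCMField.complexConj L) v) (cmLocalForm L 3 v)) ℂ).twist
        (cmTorusCharPair L v (conjInvChar (conjLocal L (IsCMField.complexConj L) v) χ₁) χ₂)).comp (cmBorelTriple L 3 v).proj) (rootDeltaChar (cmBorelTriple L 3 v).P)))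
    (hfK' : haveI := locallyCompactSpace_cmBorelU L 3 v
      fK' ∈ (Representation.smoothIndRep (cmBorelTriple L 3 v).P _).fixedPoints (cmLocalIntegralLevel L 3 (Matrix.of fun i j : Fin 3 => if i.val + j.val + 1 = 3 then (1 : L) else 0) v))
    (h1 : fK'.toFun 1 = 1) :
    ∃ J : (cmPrincipalSeries L 3 v (cmTorusCharPair L v χ₁ χ₂)).IntertwiningMap (cmPrincipalSeries L 3 v (cmTorusCharPair L v (conjInvChar (conjLocal L (IsCMField.complexConj L) v) χ₁) χ₂)),
      J ≠ 0 ∧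
      (∀ (f : haveI := locallyCompactSpace_cmBorelU L 3 v
      Representation.SmoothInd (cmBorelTriple L 3 v).P (Representation.twist (((Representation.trivial ℂ ↥(torusU (conjLocal L (IsCMField.complexConj L) v) (cmLocalForm L 3 v)) ℂ).twist
        (cmTorusCharPair L v χ₁ χ₂)).comp (cmBorelTriple L 3 v).proj) (rootDeltaChar (cmBorelTriple L 3 v).P)))
        (g : ↥(unitaryGroupOfForm (conjLocal L (IsCMField.complexConj L) v) (cmLocalForm L 3 v))),
        (J f).toFun g = ∫ n : ↥(cmBorelTriple L 3 v).N, f.toFun (w₀ * (n : ↥(unitaryGroupOfForm (conjLocal L (IsCMField.complexConj L) v) (cmLocalForm L 3 v))) * g) ∂μ) ∧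
      J fK = ((μ.real {u : ↥(cmBorelTriple L 3 v).N | (((∏ w' : PlacesOver L v, normAbs (w'.1.adicCompletion L) ((((((u : ↥(unitaryGroupOfForm (conjLocal L (IsCMField.complexConj L) v) (cmLocalForm L 3 v)))) : GL (Fin 3) (LocalRing L v)) : Matrix (Fin 3) (Fin 3) (LocalRing L v)) 0 2) w')) : ℝ≥0) : ℝ) ≤ 1} : ℂ) * ((1 + ((χ₁ ϖ : ℂˣ) : ℂ) / ((Ideal.absNorm v.asIdeal : ℕ) : ℂ)) * (1 - ((χ₁ ϖ : ℂˣ) : ℂ) / ((Ideal.absNorm v.asIdeal : ℕ) : ℂ) ^ 2) * (1 - ((χ₁ ϖ : ℂˣ) : ℂ) ^ 2)⁻¹) * fK.toFun 1) • fK' := by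
  obtain ⟨J, hJ, hJint, hJK⟩ := K2E3IntertwiningIntegralSphericalLine.exists_intertwiningIntegral_sphericalVector_eq_smul L v hns χ₁ χ₂ h₁ h₂ hs hχ₁ w₀ hw₀ μ
    fK hfK fK' hfK' h1
  refine ⟨J, hJ, hJint, ?_⟩
  rw [hJK, integral_cellFun_eq_macdonald_inert L v hns w hunrL h2w χ₁ χ₂ h₂ hχ₂ hunr hs hχ₁ ϖ hϖ w₀ hw₀ μ fK hfK]

/-! ## §4 The tame-ramified place: `c_w(χ) = μ(B₁)·(1 − z∕q_F)∕(1 − z)` -/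

set_option synthInstance.maxHeartbeats 400000 in
set_option maxHeartbeats 8000000 in
-- statement∕proof over the `SmoothInd` carrier of ★ `cmPrincipalSeries` (class of ★ `K2E3SphericalCFunctionFactorization.integral_cellFun_eq_factoredForm`)
/-- **MACDONALD'S FORMULA, TAME-RAMIFIED PLACE.**  `v` non-split with `e(w|v) ≠ 1` (ramified in `L`), `v ∤ 2` (`q_F = N𝔭_v = q_w`), `w₀` of matrix `Φ₃`, `μ` a Haar measure of `N(L⁺_v)`, `ϖ` a uniformiser
unit of `E_v`, `χ₂` continuous with `χ₂(−1) = 1`, `χ₁` UNRAMIFIED with `|χ₁(x)| = ‖x‖^s`, `s > 0`, `z = χ₁(ϖ)`, `f` a `K_v`-fixed vector of ★ `cmPrincipalSeries L 3 v (χ₁, χ₂)`.  Then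
**`∫_N f(w₀ u) dμ = μ(B₁) · (1 − z∕q_F)(1 − z)⁻¹ · f(1)`** (★ `integral_cellFun_eq_factoredForm` with `a = ‖ϖ‖ = q_F⁻¹` and `μ(B_{q_F}) = q_F μ(B₁)` ★ `K2E3HeightBallIndexRamified`; the factor `1 + z` cancels
against `1 − z²`). [cite: Rogawski1990, §4.5 p. 45] [cite: Casselman1995, §6.4 pp. 62–64] [cite: Keys1984, §4] -/
theorem integral_cellFun_eq_macdonald_ramified (hns : ∀ w : PlacesOver L v, IsCMField.complexConj L • w.1 = w.1) (w : PlacesOver L v)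
    (he : v.asIdeal.ramificationIdx' w.1.asIdeal ≠ 1) (h2w : Valued.v (2 : w.1.adicCompletion L) = 1)
    (χ₁ : (LocalRing L v)ˣ →* ℂˣ) (χ₂ : ↥(normOneUnits (conjLocal L (IsCMField.complexConj L) v)) →* ℂˣ)
    (h₂ : Continuous fun x => ((χ₂ x : ℂˣ) : ℂ)) (hχ₂ : χ₂ ⟨-1, F0P3cStCharTSBigCellFactorisation.neg_one_mem_normOneUnits (conjLocal L (IsCMField.complexConj L) v)⟩ = 1)
    (hunr : ∀ u ∈ (Submonoid.pi Set.univ (fun w : PlacesOver L v => (w.1.adicCompletionIntegers L).toSubring.toSubmonoid)).units, χ₁ u = 1) {s : ℝ} (hs : 0 < s)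
    (hχ₁ : ∀ x : (LocalRing L v)ˣ, ‖((χ₁ x : ℂˣ) : ℂ)‖ = ((unitModulusChar (LocalRing L v) x : ℝ≥0) : ℝ) ^ s)
    (ϖ : (LocalRing L v)ˣ) (hϖ : ∀ w : PlacesOver L v, Valued.v ((ϖ : LocalRing L v) w) = WithZero.exp (-1 : ℤ))
    (w₀ : ↥(unitaryGroupOfForm (conjLocal L (IsCMField.complexConj L) v) (cmLocalForm L 3 v))) (hw₀ : Units.val (w₀ : GL (Fin 3) (LocalRing L v)) = cmLocalForm L 3 v)
    [MeasurableSpace ↥(cmBorelTriple L 3 v).N] [BorelSpace ↥(cmBorelTriple L 3 v).N] (μ : Measure ↥(cmBorelTriple L 3 v).N) [μ.IsHaarMeasure]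
    (f : haveI := locallyCompactSpace_cmBorelU L 3 v
      Representation.SmoothInd (cmBorelTriple L 3 v).P (Representation.twist (((Representation.trivial ℂ ↥(torusU (conjLocal L (IsCMField.complexConj L) v) (cmLocalForm L 3 v)) ℂ).twist
        (cmTorusCharPair L v χ₁ χ₂)).comp (cmBorelTriple L 3 v).proj) (rootDeltaChar (cmBorelTriple L 3 v).P)))
    (hf : haveI := locallyCompactSpace_cmBorelU L 3 v
      f ∈ (Representation.smoothIndRep (cmBorelTriple L 3 v).P _).fixedPoints (cmLocalIntegralLevel L 3 (Matrix.of fun i j : Fin 3 => if i.val + j.val + 1 = 3 then (1 : L) else 0) v)) :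
    ∫ u : ↥(cmBorelTriple L 3 v).N, f.toFun (w₀ * (u : ↥(unitaryGroupOfForm (conjLocal L (IsCMField.complexConj L) v) (cmLocalForm L 3 v)))) ∂μ =
      (μ.real {u : ↥(cmBorelTriple L 3 v).N | (((∏ w' : PlacesOver L v, normAbs (w'.1.adicCompletion L) ((((((u : ↥(unitaryGroupOfForm (conjLocal L (IsCMField.complexConj L) v) (cmLocalForm L 3 v)))) : GL (Fin 3) (LocalRing L v)) : Matrix (Fin 3) (Fin 3) (LocalRing L v)) 0 2) w')) : ℝ≥0) : ℝ) ≤ 1} : ℂ) * ((1 - ((χ₁ ϖ : ℂˣ) : ℂ) / ((Ideal.absNorm v.asIdeal : ℕ) : ℂ)) * (1 - ((χ₁ ϖ : ℂˣ) : ℂ))⁻¹) * f.toFun 1 := by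
  have hw := hns w
  have ha0 : 0 < ((unitModulusChar (LocalRing L v) ϖ : ℝ≥0) : ℝ) := NNReal.coe_pos.2 distribHaarChar_pos
  have ha1 : ((unitModulusChar (LocalRing L v) ϖ : ℝ≥0) : ℝ) < 1 := by exact_mod_cast K2E3SphericalCFunctionShellExpansion.unitModulusChar_uniformizer_lt_one L v hns ϖ hϖ
  have hz : ‖((χ₁ ϖ : ℂˣ) : ℂ)‖ < 1 := by rw [hχ₁ ϖ]; exact Real.rpow_lt_one ha0.le ha1 hs
  have hz1 : (1 : ℂ) - ((χ₁ ϖ : ℂˣ) : ℂ) ≠ 0 := by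
    intro h
    rw [sub_eq_zero] at h
    rw [← h, norm_one] at hz
    exact lt_irrefl _ hz
  have hz1' : (1 : ℂ) + ((χ₁ ϖ : ℂˣ) : ℂ) ≠ 0 := by
    intro h
    rw [add_eq_zero_iff_eq_neg] at h
    rw [← neg_neg ((χ₁ ϖ : ℂˣ) : ℂ), ← h, norm_neg, norm_one] at hz
    exact lt_irrefl _ hz
  have hq0 : ((Ideal.absNorm v.asIdeal : ℕ) : ℂ) ≠ 0 := by exact_mod_cast fun h => v.ne_bot (Ideal.absNorm_eq_zero_iff.1 h)
  have ha : ((unitModulusChar (LocalRing L v) ϖ : ℝ≥0) : ℝ) = (((Ideal.absNorm v.asIdeal : ℕ) : ℝ))⁻¹ := by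
    rw [K2E3HeightBallIndexRamified.unitModulusChar_uniformizer_of_ramified L v w hw he ϖ hϖ, NNReal.coe_inv, NNReal.coe_natCast]
  rw [K2E3SphericalCFunctionFactorization.integral_cellFun_eq_factoredForm L v hns χ₁ χ₂ h₂ hχ₂ hunr hs hχ₁ ϖ hϖ w₀ hw₀ μ f hf,
    K2E3HeightBallIndexRamified.measureReal_heightBall_inv_eq_mul_of_ramified L v w hw he h2w ϖ hϖ μ, ha]
  set M₀ : ℝ := μ.real {u : ↥(cmBorelTriple L 3 v).N | (((∏ w' : PlacesOver L v, normAbs (w'.1.adicCompletion L) ((((((u : ↥(unitaryGroupOfForm (conjLocal L (IsCMField.complexConj L) v) (cmLocalForm L 3 v)))) : GL (Fin 3) (LocalRing L v)) : Matrix (Fin 3) (Fin 3) (LocalRing L v)) 0 2) w')) : ℝ≥0) : ℝ) ≤ 1} with hM₀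
  have h1z2 : (1 : ℂ) - ((χ₁ ϖ : ℂˣ) : ℂ) ^ 2 = (1 - ((χ₁ ϖ : ℂˣ) : ℂ)) * (1 + ((χ₁ ϖ : ℂˣ) : ℂ)) := by ring
  rw [h1z2]
  push_cast
  field_simp

set_option synthInstance.maxHeartbeats 400000 in
set_option maxHeartbeats 8000000 in
-- statement∕proof over two `SmoothInd` carriers of ★ `cmPrincipalSeries` (class of ★ `K2E3SphericalCFunctionFactorization.exists_intertwiningIntegral_sphericalVector_eq_factoredForm_smul`)
/-- **HARISH-CHANDRA'S `c`-FUNCTION AT A TAME-RAMIFIED PLACE** (docked on ★ I-2a).  Hypotheses as in `integral_cellFun_eq_macdonald_ramified`, plus `χ₁` continuous and `f_K ∈ i_G(χ)^{K_v}`,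
`f'_K ∈ i_G(wχ)^{K_v}` with `f'_K(1) = 1`.  Then the intertwining integral `J ≠ 0` of ★ RUNG 3 satisfies **`J f_K = (μ(B₁)·(1 − z∕q_F)(1 − z)⁻¹ · f_K(1)) • f'_K`**; normalised,
**`c_w(χ) = (1 − q_F⁻¹ z)∕(1 − z)`** — non-vanishing on `|z| < 1`, with the single zero `z = q_F` ⟷ `χ₁ = ‖·‖_E` read at `z⁻¹` (Keys' case (2) needs `η|_{F^×} = ω_{E∕F}`, ramified here, so it is
absent from the unramified line). [cite: Rogawski1990, §4.5 p. 45; §12.2 p. 173] [cite: Casselman1995, §6.4 pp. 62–64] [cite: Keys1984, §4, §7 Thm (2)] -/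
theorem exists_intertwiningIntegral_sphericalVector_eq_macdonald_ramified_smul (hns : ∀ w : PlacesOver L v, IsCMField.complexConj L • w.1 = w.1) (w : PlacesOver L v)
    (he : v.asIdeal.ramificationIdx' w.1.asIdeal ≠ 1) (h2w : Valued.v (2 : w.1.adicCompletion L) = 1)
    (χ₁ : (LocalRing L v)ˣ →* ℂˣ) (χ₂ : ↥(normOneUnits (conjLocal L (IsCMField.complexConj L) v)) →* ℂˣ)
    (h₁ : Continuous fun x => ((χ₁ x : ℂˣ) : ℂ)) (h₂ : Continuous fun x => ((χ₂ x : ℂˣ) : ℂ)) (hχ₂ : χ₂ ⟨-1, F0P3cStCharTSBigCellFactorisation.neg_one_mem_normOneUnits (conjLocal L (IsCMField.complexConj L) v)⟩ = 1)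
    (hunr : ∀ u ∈ (Submonoid.pi Set.univ (fun w : PlacesOver L v => (w.1.adicCompletionIntegers L).toSubring.toSubmonoid)).units, χ₁ u = 1) {s : ℝ} (hs : 0 < s)
    (hχ₁ : ∀ x : (LocalRing L v)ˣ, ‖((χ₁ x : ℂˣ) : ℂ)‖ = ((unitModulusChar (LocalRing L v) x : ℝ≥0) : ℝ) ^ s)
    (ϖ : (LocalRing L v)ˣ) (hϖ : ∀ w : PlacesOver L v, Valued.v ((ϖ : LocalRing L v) w) = WithZero.exp (-1 : ℤ))
    (w₀ : ↥(unitaryGroupOfForm (conjLocal L (IsCMField.complexConj L) v) (cmLocalForm L 3 v))) (hw₀ : Units.val (w₀ : GL (Fin 3) (LocalRing L v)) = cmLocalForm L 3 v)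
    [MeasurableSpace ↥(cmBorelTriple L 3 v).N] [BorelSpace ↥(cmBorelTriple L 3 v).N] (μ : Measure ↥(cmBorelTriple L 3 v).N) [μ.IsHaarMeasure]
    (fK : haveI := locallyCompactSpace_cmBorelU L 3 v
      Representation.SmoothInd (cmBorelTriple L 3 v).P (Representation.twist (((Representation.trivial ℂ ↥(torusU (conjLocal L (IsCMField.complexConj L) v) (cmLocalForm L 3 v)) ℂ).twist
        (cmTorusCharPair L v χ₁ χ₂)).comp (cmBorelTriple L 3 v).proj) (rootDeltaChar (cmBorelTriple L 3 v).P)))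
    (hfK : haveI := locallyCompactSpace_cmBorelU L 3 v
      fK ∈ (Representation.smoothIndRep (cmBorelTriple L 3 v).P _).fixedPoints (cmLocalIntegralLevel L 3 (Matrix.of fun i j : Fin 3 => if i.val + j.val + 1 = 3 then (1 : L) else 0) v))
    (fK' : haveI := locallyCompactSpace_cmBorelU L 3 v
      Representation.SmoothInd (cmBorelTriple L 3 v).P (Representation.twist (((Representation.trivial ℂ ↥(torusU (conjLocal L (IsCMField.complexConj L) v) (cmLocalForm L 3 v)) ℂ).twist
        (cmTorusCharPair L v (conjInvChar (conjLocal L (IsCMField.complexConj L) v) χ₁) χ₂)).comp (cmBorelTriple L 3 v).proj) (rootDeltaChar (cmBorelTriple L 3 v).P)))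
    (hfK' : haveI := locallyCompactSpace_cmBorelU L 3 v
      fK' ∈ (Representation.smoothIndRep (cmBorelTriple L 3 v).P _).fixedPoints (cmLocalIntegralLevel L 3 (Matrix.of fun i j : Fin 3 => if i.val + j.val + 1 = 3 then (1 : L) else 0) v))
    (h1 : fK'.toFun 1 = 1) :
    ∃ J : (cmPrincipalSeries L 3 v (cmTorusCharPair L v χ₁ χ₂)).IntertwiningMap (cmPrincipalSeries L 3 v (cmTorusCharPair L v (conjInvChar (conjLocal L (IsCMField.complexConj L) v) χ₁) χ₂)),
      J ≠ 0 ∧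
      (∀ (f : haveI := locallyCompactSpace_cmBorelU L 3 v
      Representation.SmoothInd (cmBorelTriple L 3 v).P (Representation.twist (((Representation.trivial ℂ ↥(torusU (conjLocal L (IsCMField.complexConj L) v) (cmLocalForm L 3 v)) ℂ).twist
        (cmTorusCharPair L v χ₁ χ₂)).comp (cmBorelTriple L 3 v).proj) (rootDeltaChar (cmBorelTriple L 3 v).P)))
        (g : ↥(unitaryGroupOfForm (conjLocal L (IsCMField.complexConj L) v) (cmLocalForm L 3 v))),
        (J f).toFun g = ∫ n : ↥(cmBorelTriple L 3 v).N, f.toFun (w₀ * (n : ↥(unitaryGroupOfForm (conjLocal L (IsCMField.complexConj L) v) (cmLocalForm L 3 v))) * g) ∂μ) ∧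
      J fK = ((μ.real {u : ↥(cmBorelTriple L 3 v).N | (((∏ w' : PlacesOver L v, normAbs (w'.1.adicCompletion L) ((((((u : ↥(unitaryGroupOfForm (conjLocal L (IsCMField.complexConj L) v) (cmLocalForm L 3 v)))) : GL (Fin 3) (LocalRing L v)) : Matrix (Fin 3) (Fin 3) (LocalRing L v)) 0 2) w')) : ℝ≥0) : ℝ) ≤ 1} : ℂ) * ((1 - ((χ₁ ϖ : ℂˣ) : ℂ) / ((Ideal.absNorm v.asIdeal : ℕ) : ℂ)) * (1 - ((χ₁ ϖ : ℂˣ) : ℂ))⁻¹) * fK.toFun 1) • fK' := by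
  obtain ⟨J, hJ, hJint, hJK⟩ := K2E3IntertwiningIntegralSphericalLine.exists_intertwiningIntegral_sphericalVector_eq_smul L v hns χ₁ χ₂ h₁ h₂ hs hχ₁ w₀ hw₀ μ
    fK hfK fK' hfK' h1
  refine ⟨J, hJ, hJint, ?_⟩
  rw [hJK, integral_cellFun_eq_macdonald_ramified L v hns w he h2w χ₁ χ₂ h₂ hχ₂ hunr hs hχ₁ ϖ hϖ w₀ hw₀ μ fK hfK]

end Summit.HodgeConjecture.HodgeConjecture.Cruxes.H413.K2E3SphericalCFunctionMacdonald

end
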